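import Summits.Ventures.PercRepro.S2CoreSeventeenSplit
import Summits.Ventures.PercRepro.S2ColoopSharp

/-!
# PercRepro — S2: THE CELL `(13, 7)` MODULO ITS THREE SUB-CELLS (p7, gen 16; sub-claim S2; the second cell of the row `p = 13`)

The double coloop split of the cell `(13, 7)` (`RLS M 13 5` on every `e`-free core of rank `13` on `20` points), the skeleton of
`S2ThirteenSix` at corank `7`: two coloops give the twice-scaled cell `(11, 7)` at `K₂ = 12107` (hypothesis `hk2`:
`(Φ(13,5) − 6)/4 · #U(11,5) ≤ mid(11,5)` on every `e`-free core of rank `11` on `18` points), one coloop the scaled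
coloop-free cell `(12, 7)` at `K₁ = 10219` (`hk1`), no coloop the coloop-free cell `(13, 7)` itself (`hcf`).
**`c025_core_five_thirteen_seven_of_cells`** is the assembly; every sub-cell is OPEN (the g15 pricing reads `1.06 … 1.19` on the
spread case of `(13, 7)` with the corank-`7` lever of `(14, 7)` and `1.38` / `1.02` on its concentrated cases `ν = 4, 5`, lane
mining/plan137b.py). NO cell and NO window move is claimed: the window of record is `8 ≤ p ≤ 14` (ADDENDUM 99). Axioms: standard.
-/

open scoped Matroid

namespace PercRepro

namespace ThmN

open Set

variable {α : Type}

/-- **The cell `(13, 7)` modulo its three sub-cells**: the coloop-free cell `(13, 7)`, the scaled coloop-free cell `(12, 7)`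
at `(Φ − 2)/2` and the twice-scaled cell `(11, 7)` at `(Φ − 6)/4`. -/
theorem c025_core_five_thirteen_seven_of_cells
    (hcf : ∀ (M : Matroid α) [M.Finite], M.eRank = ((13 : ℕ) : ℕ∞) → M.E.ncard = 13 + 7 →
      (∀ e ∈ M.E, ∃ A ⊆ M.E \ {e}, e ∉ M.closure A ∧ e ∉ M.closure ((M.E \ {e}) \ A)) → (∀ e, ¬ M.IsColoop e) →
      RLS M 13 5)
    (hk1 : ∀ (M : Matroid α) [M.Finite], M.eRank = ((12 : ℕ) : ℕ∞) → M.E.ncard = 12 + 7 →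
      (∀ e ∈ M.E, ∃ A ⊆ M.E \ {e}, e ∉ M.closure A ∧ e ∉ M.closure ((M.E \ {e}) \ A)) → (∀ e, ¬ M.IsColoop e) →
      ((phiK 13 5 - 2) / 2) * (Matroid.topCount M 12 5 : ℚ) ≤ (Matroid.midCount M 12 5 : ℚ))
    (hk2 : ∀ (M : Matroid α) [M.Finite], M.eRank = ((11 : ℕ) : ℕ∞) → M.E.ncard = 11 + 7 →
      (∀ e ∈ M.E, ∃ A ⊆ M.E \ {e}, e ∉ M.closure A ∧ e ∉ M.closure ((M.E \ {e}) \ A)) →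
      ((phiK 13 5 - 6) / 4) * (Matroid.topCount M 11 5 : ℚ) ≤ (Matroid.midCount M 11 5 : ℚ))
    (M : Matroid α) [M.Finite]
    (hR : M.eRank = ((13 : ℕ) : ℕ∞)) (hn : M.E.ncard = 13 + 7)
    (hfree : ∀ e ∈ M.E, ∃ A ⊆ M.E \ {e}, e ∉ M.closure A ∧ e ∉ M.closure ((M.E \ {e}) \ A)) : RLS M 13 5 := by
  classical
  by_cases hK : ∃ e, M.IsColoop e
  · obtain ⟨e, he⟩ := hK
    obtain ⟨hn', hR', hfree', -⟩ := delete_core_data M he (p := 12) (d := 7) (by rw [hR]) hn hfree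
    rw [RLS_iff]
    by_cases hK' : ∃ f, (M ＼ {e}).IsColoop f
    · obtain ⟨f, hf⟩ := hK'
      obtain ⟨hn'', hR'', hfree'', -⟩ := delete_core_data (M ＼ {e}) hf (p := 11) (d := 7) (by rw [hR']) hn' hfree'
      have key := hk2 ((M ＼ {e}) ＼ {f}) hR'' hn'' hfree''
      exact weighted_of_isColoop_scaled_sharp_iter M he hf (by norm_num : 4 + 1 < 11) (by rw [hR]) (phiK 13 5) key
    · push Not at hK'
      have key := hk1 (M ＼ {e}) hR' hn' hfree' hK'
      exact weighted_of_isColoop_scaled_sharp M he (by norm_num : 4 + 1 < 12) (by rw [hR]) (phiK 13 5) key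
  · push Not at hK
    exact hcf M hR hn hfree hK

end ThmN

end PercRepro
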